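import Summits.QuantumAdvantage.AdviceFreeQNC0.NPGamma37Sparse
import Summits.QuantumAdvantage.AdviceFreeQNC0.NPGamma37Few
import Summits.QuantumAdvantage.AdviceFreeQNC0.NPGamma37FanIn
import HarnessLib

/-!
# Cell qa-qnc0 — (NP-Γ) COROLLARIES, unconditional (planner qa-qnc0-p2 g34, ROUND-34P2 §4.6, INBOX P2-34e/f)

* `ringHardFewCouplings3 : NPGamma37.RingHardFewCouplings3` — from `ringHardSparse3_explicit` (NPGamma37Sparse) by the
  zone-greedy window selection `NPGamma37Few.ringHardFewCouplings3_of_sparse`; constants `e = 6`, `C = 2^21`, `n₀ = 4096`.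
* `ringHardFanIn3 : NPGamma37FanIn.RingHardFanIn3` — the FAN-IN LAW, from the previous by `NPGamma37FanIn.ringHardFanIn3_of_few`.

Both are `1 − n^{-6}` laws (rungs), NOT the uniform `θ < 1` of crux 22907 / `RingHardOdd 3`.
-/

namespace Summit.QuantumAdvantage.AdviceFreeQNC0.NPGamma37Proof

open Summit.QuantumAdvantage.AdviceFreeQNC0.NPGamma37 (RingHardFewCouplings3)

/-- **`RingHardFewCouplings3` PROVED** (`e = 6`, `C = 2^21`, `n₀ = 4096`): every 𝔽₃-polynomial strategy (any degree)
whose monomial supports couple at most `n² / (2^21 (log₂ n)^3)` pairs of positions wins on at most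
`(1 − n^{-6})·2^{n−1}` odd inputs — by the zone-greedy window selection of `NPGamma37Few`. -/
theorem ringHardFewCouplings3 : RingHardFewCouplings3 :=
  NPGamma37Few.ringHardFewCouplings3_of_sparse ringHardSparse3_explicit

/-- **FAN-IN LAW PROVED** (`e = 6`, `C = 2^21`, `n₀ = 4096`): every classical strategy whose `i`-th output is an arbitrary
function of inputs `R i` with `(Σ_i |R i|²)·2^21·(log₂ n)^3 ≤ n²` (e.g. all fan-ins `≤ √n/(1449 (log₂ n)^{3/2})`) wins on at most
`(1 − n^{-6})·2^{n−1}` odd inputs of the `p = 3` ring relation. -/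
theorem ringHardFanIn3 : NPGamma37FanIn.RingHardFanIn3 :=
  NPGamma37FanIn.ringHardFanIn3_of_few ringHardFewCouplings3

end Summit.QuantumAdvantage.AdviceFreeQNC0.NPGamma37Proof
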